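import Mathlib.Tactic
import HarnessLib

/-!
# The weight-gauge law of the design alphabet of `t3_080 h+w₁`

Kernel certificate for §4 of `widen/W1/HLANG-w1aut2.md` (cell `pub-hsemireg`, W1, seat w1-aut-2 gen 14).
The six slot letters of the design are `−𝒫₁ = −c₁+p+q`, `𝒫₂ = c₂−p−q`, `−𝒫₂ = −c₂+p+q`, `H = p+q`, `−H = −p−q`, `q`.
For an ordered pair of letters `(a, b)` and a degree `t ∈ {0,1,2}` the engine's character table gives the SET of
`μ₆`-weights (mod 6) occurring in `H^t(S, 𝒪(b − a))` (data transcribed from the lineage's `chartable.py`, sha256∕16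
`06135ad7e7669a52`, curve `ω`, `K = 6`; 62 nonempty keys, the same table the census DP `enddec2.py` consumes).

We certify by `decide`:
* `law` — every occurring weight `w` satisfies `w − t − (g b − g a) ∈ S a b t (mod 6)` for the GAUGE `g(H) = 5 ≡ −1`,
  `g(−H) = 1`, `g = 0` otherwise, and the DEFECT SETS `S` listed below; and conversely every element of the shifted
  defect set occurs (`law_iff`) — i.e. weight set `= g(b) − g(a) + t + S`;
* `free_keys` — `S ≠ {0}` on exactly 8 keys (`−𝒫₁ ↔ −𝒫₂` at `t = 1`: `{0,3}`; `𝒫₂ ↔ −𝒫₂` at `t = 1` and the two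
  `H`-flips: `{0,2,4}`; `−H → q` at `t = 0`: `{0,4}`; `q → −H` at `t = 2`: `{0,2}`), and `determined` — on the other 54
  keys the weight is a FUNCTION of (letters, degree);
* `telescope` ∕ `block_formula` — along any composable list of leaves the gauge terms telescope, so the total weight of
  a sub-word is `g(end) − g(start) + (total degree) + (total defect)`, and for a CLOSED word the root weight law
  `Σ w ≡ c` reads `c − Σ t ≡ Σ defects` (`root_law_closed_form`; by `law` each defect lies in its leaf's `S` mod 6).

Honest framing: a finite combinatorial certificate about one design's character table plus a telescoping identity;
it re-derives nothing about the surface, and nothing here bears on HC / HC_CM / HC_AV.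
-/

namespace Summit.Ventures.HSemireg.WeightGaugeLaw

/-- The slot alphabet of the design `t3_080 h+w₁`. -/
inductive L | mP1 | P2 | mP2 | H | mH | q
  deriving DecidableEq, Repr

open L

/-- The six letters enumerate `L` (needed for `decide` over `∀ a b : L`). -/
instance : Fintype L := ⟨⟨[mP1, P2, mP2, H, mH, q], by decide⟩, fun x => by cases x <;> decide⟩

/-- Weight sets (mod 6) of `H^t(S, 𝒪(b − a))`, transcribed from the character table; `[]` = the group vanishes. -/
def wset : L → L → ℕ → List ℕ
  | mP1, mP1, 0 => [0]
  | mP1, mP1, 1 => [1]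
  | mP1, mP1, 2 => [2]
  | mP1, P2, 1 => [1]
  | mP1, mP2, 1 => [1, 4]
  | mP1, H, 0 => [5]
  | mP1, H, 1 => [0]
  | mP1, mH, 1 => [2]
  | mP1, mH, 2 => [3]
  | mP1, q, 1 => [1]
  | P2, mP1, 1 => [1]
  | P2, P2, 0 => [0]
  | P2, P2, 1 => [1]
  | P2, P2, 2 => [2]
  | P2, mP2, 1 => [1, 3, 5]
  | P2, H, 0 => [5]
  | P2, H, 1 => [0]
  | P2, mH, 1 => [2]
  | P2, mH, 2 => [3]
  | P2, q, 1 => [1]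
  | mP2, mP1, 1 => [1, 4]
  | mP2, P2, 1 => [1, 3, 5]
  | mP2, mP2, 0 => [0]
  | mP2, mP2, 1 => [1]
  | mP2, mP2, 2 => [2]
  | mP2, H, 0 => [5]
  | mP2, H, 1 => [0]
  | mP2, mH, 1 => [2]
  | mP2, mH, 2 => [3]
  | mP2, q, 1 => [1]
  | H, mP1, 1 => [2]
  | H, mP1, 2 => [3]
  | H, P2, 1 => [2]
  | H, P2, 2 => [3]
  | H, mP2, 1 => [2]
  | H, mP2, 2 => [3]
  | H, H, 0 => [0]
  | H, H, 1 => [1]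
  | H, H, 2 => [2]
  | H, mH, 2 => [0, 2, 4]
  | H, q, 1 => [2]
  | H, q, 2 => [3]
  | mH, mP1, 0 => [5]
  | mH, mP1, 1 => [0]
  | mH, P2, 0 => [5]
  | mH, P2, 1 => [0]
  | mH, mP2, 0 => [5]
  | mH, mP2, 1 => [0]
  | mH, H, 0 => [0, 2, 4]
  | mH, mH, 0 => [0]
  | mH, mH, 1 => [1]
  | mH, mH, 2 => [2]
  | mH, q, 0 => [3, 5]
  | q, mP1, 1 => [1]
  | q, P2, 1 => [1]
  | q, mP2, 1 => [1]
  | q, H, 0 => [5]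
  | q, H, 1 => [0]
  | q, mH, 2 => [3, 5]
  | q, q, 0 => [0]
  | q, q, 1 => [1]
  | q, q, 2 => [2]
  | _, _, _ => []

/-- The gauge: `g(H) = −1`, `g(−H) = +1`, `0` on `−𝒫₁, ±𝒫₂, q` (values mod 6). -/
def g : L → ℕ
  | H => 5 | mH => 1 | _ => 0

/-- The defect sets: `{0}` except on the 8 free keys. -/
def S : L → L → ℕ → List ℕ
  | mP1, mP2, 1 => [0, 3] | mP2, mP1, 1 => [0, 3]
  | P2, mP2, 1 => [0, 2, 4] | mP2, P2, 1 => [0, 2, 4]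
  | H, mH, 2 => [0, 2, 4] | mH, H, 0 => [0, 2, 4]
  | mH, q, 0 => [0, 4] | q, mH, 2 => [0, 2]
  | _, _, _ => [0]

/-- The base weight `g(b) − g(a) + t` (mod 6, computed in `ℕ` with `+ 6` to avoid truncated subtraction). -/
def base (a b : L) (t : ℕ) : ℕ := (g b + 6 - g a + t) % 6

/-- THE LAW, membership form: every occurring weight is `base + defect` for some defect in `S`. -/
theorem law : ∀ a b : L, ∀ t ∈ [0, 1, 2], ∀ w ∈ wset a b t, (w + 6 - base a b t) % 6 ∈ S a b t := by decide

/-- THE LAW, set form: on every nonempty key the occurring weights are EXACTLY `base + S` (residues mod 6). -/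
theorem law_iff : ∀ a b : L, ∀ t ∈ [0, 1, 2], wset a b t ≠ [] → ∀ w ∈ [0, 1, 2, 3, 4, 5],
    (w ∈ wset a b t ↔ (w + 6 - base a b t) % 6 ∈ S a b t) := by decide

/-- The 8 free keys: exactly where the defect set is not `{0}` (among the 62 nonempty keys). -/
theorem free_keys : ∀ a b : L, ∀ t ∈ [0, 1, 2],
    (wset a b t ≠ [] ∧ S a b t ≠ [0]) ↔ (a, b, t) ∈ [(mP1, mP2, 1), (mP2, mP1, 1), (P2, mP2, 1), (mP2, P2, 1),
      (H, mH, 2), (mH, H, 0), (mH, q, 0), (q, mH, 2)] := by decide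

/-- On the other 54 nonempty keys the weight is determined by (letters, degree). -/
theorem determined : ∀ a b : L, ∀ t ∈ [0, 1, 2],
    S a b t = [0] → wset a b t ≠ [] → wset a b t = [base a b t] := by decide

/-- There are exactly 62 nonempty keys, 54 of them determined. -/
theorem key_count :
    (((([mP1, P2, mP2, H, mH, q].product [mP1, P2, mP2, H, mH, q]).product [0, 1, 2]).filter
        fun k => wset k.1.1 k.1.2 k.2 ≠ []).length = 62) ∧
    (((([mP1, P2, mP2, H, mH, q].product [mP1, P2, mP2, H, mH, q]).product [0, 1, 2]).filter
        fun k => wset k.1.1 k.1.2 k.2 ≠ [] ∧ S k.1.1 k.1.2 k.2 = [0]).length = 54) := by decide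

/-- A leaf of a census word in one slot: from-letter, to-letter, Künneth degree, weight. -/
structure Leaf where
  a : L
  b : L
  t : ℕ
  w : ℕ
  deriving DecidableEq, Repr

/-- Composable list of leaves (a path in the letter graph): consecutive letters match. -/
def composable : List Leaf → Bool
  | [] => true
  | [_] => true
  | x :: y :: r => (x.b == y.a) && composable (y :: r)

/-- The defect of a leaf: `w − t − (g b − g a)` (an integer; by `law` it lies in `S` mod 6 when `w` occurs). -/
def defect (l : Leaf) : ℤ := (l.w : ℤ) - l.t - ((g l.b : ℤ) - g l.a)

/-- Termwise bookkeeping: total weight = total gauge + total degree + total defect (any list). -/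
theorem sum_split (p : List Leaf) :
    (p.map fun l => (l.w : ℤ)).sum
      = (p.map fun l => (g l.b : ℤ) - g l.a).sum + (p.map fun l => (l.t : ℤ)).sum + (p.map defect).sum := by
  induction p with
  | nil => simp
  | cons x r ih =>
    simp only [List.map_cons, List.sum_cons, ih, defect]
    ring

/-- The gauge terms telescope along a composable nonempty path. -/
theorem telescope : ∀ (p : List Leaf) (x : Leaf), composable (x :: p) = true →
    ((x :: p).map fun l => (g l.b : ℤ) - g l.a).sum = (g ((x :: p).getLast (by simp)).b : ℤ) - g x.a := by
  intro p
  induction p with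
  | nil => intro x _; simp
  | cons y r ih =>
    intro x hc
    have hxy : x.b = y.a := by
      simp only [composable, Bool.and_eq_true, beq_iff_eq] at hc; exact hc.1
    have hc' : composable (y :: r) = true := by
      simp only [composable, Bool.and_eq_true, beq_iff_eq] at hc; exact hc.2
    have := ih y hc'
    simp only [List.map_cons, List.sum_cons] at this ⊢
    rw [this, hxy]
    simp

/-- BLOCK FORMULA: along a composable path, total weight = g(end) − g(start) + total degree + total defect. -/
theorem block_formula (p : List Leaf) (x : Leaf) (hc : composable (x :: p) = true) :
    ((x :: p).map fun l => (l.w : ℤ)).sum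
      = ((g ((x :: p).getLast (by simp)).b : ℤ) - g x.a) + ((x :: p).map fun l => (l.t : ℤ)).sum
        + ((x :: p).map defect).sum := by
  rw [← telescope p x hc]
  exact sum_split (x :: p)

/-- ROOT WEIGHT LAW IN CLOSED FORM: on a CLOSED composable path (end letter = start letter) the gauge drops out,
`Σ w = Σ t + Σ defects`; so the census's root weight law `Σ w ≡ c (mod 6)` is the condition
`c − Σ t ≡ Σ defects (mod 6)`, each defect ranging over its leaf's `S` by `law`. -/
theorem root_law_closed_form (p : List Leaf) (x : Leaf) (hc : composable (x :: p) = true)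
    (hclosed : ((x :: p).getLast (by simp)).b = x.a) :
    ((x :: p).map fun l => (l.w : ℤ)).sum = ((x :: p).map fun l => (l.t : ℤ)).sum + ((x :: p).map defect).sum := by
  have h := block_formula p x hc
  rw [hclosed] at h
  linarith

end Summit.Ventures.HSemireg.WeightGaugeLaw
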